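import Mathlib.Analysis.ODE.ExistUnique
import Mathlib.Analysis.CStarAlgebra.Matrix
import Mathlib.Topology.UniformSpace.Matrix
import Mathlib.Analysis.Matrix.Hermitian
import HarnessLib

/-!
# Linear matrix differential equations and the unitary flow of a Hermitian generator

Tenth file of the formalisation of the Michalakis–Zwolak stability theorem (hubbard.S19): the
quasi-adiabatic (spectral-flow) unitary `U(s)`, `∂_s U(s) = i D(s) U(s)`, `U(0) = 1`
(Michalakis–Zwolak, arXiv:1109.1588 §5.2: "`∂_s U_Y(s) = i D_Y(s) U_Y(s)`, `U_Y(0) = 𝟙`"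
and "the unitary `U(s)` satisfies `U(s) P₀ U†(s) = P₀(s)`", after
Bachmann–Michalakis–Nachtergaele–Sims 2011, eq. (4.42)–(4.46) and Proposition 2.4).

* `exists_linearODE_solution`: global solutions on `[0, T]` of `U' = A(s) U` for a continuous
  bounded matrix coefficient. Mathlib provides the local Picard–Lindelöf theorem
  (`IsPicardLindelof.exists_eq_forall_mem_Icc_hasDerivWithinAt₀`); the linear field
  `(t, U) ↦ A(t) U` is stepped along intervals of the uniform length `1/(2M + 1)` (`‖A‖ ≤ M`; on
  the ball of radius `‖U₀‖ + 1` the field is bounded by `M(2‖U₀‖ + 1)`, so the time condition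
  holds independently of `U₀`) and the pieces are glued with `HasDerivWithinAt.union`.
* `exists_unitary_flow`: for a continuous bounded pointwise-Hermitian `D` and any `P` satisfying
  Hastings' equation `P' = i[D(s), P(s)]` on `[0, T]`, the solution of `U' = iD(s)U`, `U(0) = 1`
  is unitary (`Uᴴ U = U Uᴴ = 1`, since `(Uᴴ U)' = 0`) and intertwines, `U(s)ᴴ P(s) U(s) = P(0)`
  (since `(Uᴴ P U)' = Uᴴ(−iDP + i[D,P] + iPD)U = 0`), by `constant_of_has_deriv_right_zero`.

No definitions, no named facts (theorems only). [folklore]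
-/

noncomputable section

open Set Metric Filter
open scoped Matrix Matrix.Norms.L2Operator Topology NNReal

namespace Literature.MathematicalPhysics.QuantumLattice

variable {n : Type*} [Fintype n] [DecidableEq n]

/-- One Picard–Lindelöf step for the linear field `(t, U) ↦ A(t) U`: on an interval of length
`h ≤ 1/(2M+1)` starting at `t₁`, with any initial value. [folklore] -/
theorem exists_linearODE_step {A : ℝ → Matrix n n ℂ} (hA : Continuous A) {M : ℝ} (hM0 : 0 ≤ M)
    (hM : ∀ s, ‖A s‖ ≤ M) (t₁ h : ℝ) (hh0 : 0 ≤ h) (hh : h * (2 * M + 1) ≤ 1)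
    (x₀ : Matrix n n ℂ) :
    ∃ V : ℝ → Matrix n n ℂ, V t₁ = x₀ ∧
      ∀ t ∈ Icc t₁ (t₁ + h), HasDerivWithinAt V (A t * V t) (Icc t₁ (t₁ + h)) t := by
  have ht₁ : t₁ ∈ Icc t₁ (t₁ + h) := ⟨le_rfl, by linarith⟩
  set a : ℝ≥0 := ⟨‖x₀‖ + 1, by positivity⟩ with ha
  set L : ℝ≥0 := ⟨M * (2 * ‖x₀‖ + 1), by positivity⟩ with hL
  set K : ℝ≥0 := ⟨M, hM0⟩ with hK
  have hLval : (L : ℝ) = M * (2 * ‖x₀‖ + 1) := rfl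
  have haval : (a : ℝ) = ‖x₀‖ + 1 := rfl
  have hPL : IsPicardLindelof (fun t U => A t * U) (⟨t₁, ht₁⟩ : Icc t₁ (t₁ + h)) x₀ a 0 L K := by
    refine ⟨fun t _ => ?_, fun x _ => ?_, fun t _ x hx => ?_, ?_⟩
    · refine LipschitzWith.lipschitzOnWith (LipschitzWith.of_dist_le_mul fun x y => ?_)
      rw [dist_eq_norm, dist_eq_norm, ← Matrix.mul_sub]
      exact (Matrix.l2_opNorm_mul _ _).trans (mul_le_mul_of_nonneg_right (hM t) (norm_nonneg _))
    · exact ((hA.mul continuous_const).continuousOn)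
    · rw [mem_closedBall, dist_eq_norm] at hx
      have hx' : ‖x‖ ≤ ‖x₀‖ + (‖x₀‖ + 1) := by
        have := norm_le_norm_add_norm_sub' x x₀
        have h2 : ‖x - x₀‖ ≤ ‖x₀‖ + 1 := hx
        linarith [norm_sub_rev x x₀]
      calc ‖A t * x‖ ≤ ‖A t‖ * ‖x‖ := Matrix.l2_opNorm_mul _ _
        _ ≤ M * (‖x₀‖ + (‖x₀‖ + 1)) := mul_le_mul (hM t) hx' (norm_nonneg _) hM0
        _ = (L : ℝ) := by rw [hLval]; ring
    · -- `L * max (tmax - t₀) (t₀ - tmin) ≤ a - 0`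
      have hmax : max (t₁ + h - t₁) (t₁ - t₁) = h := by
        rw [add_sub_cancel_left, sub_self, max_eq_left hh0]
      have h1 : M * (2 * ‖x₀‖ + 1) ≤ (2 * M + 1) * (‖x₀‖ + 1) := by nlinarith [norm_nonneg x₀]
      have h2 : (2 * M + 1) * (‖x₀‖ + 1) * h ≤ ‖x₀‖ + 1 := by nlinarith [norm_nonneg x₀]
      show (L : ℝ) * max (t₁ + h - t₁) (t₁ - t₁) ≤ (a : ℝ) - ((0 : ℝ≥0) : ℝ)
      rw [hmax, hLval, haval, NNReal.coe_zero, sub_zero]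
      nlinarith [norm_nonneg x₀]
  exact hPL.exists_eq_forall_mem_Icc_hasDerivWithinAt₀

/-- Gluing two solutions: a solution on `[0, τ]` and a solution on `[τ, τ + h]` with matching value
at `τ` give a solution on `[0, τ + h]`. [folklore] -/
theorem glue_linearODE {A : ℝ → Matrix n n ℂ} {τ h : ℝ} (hτ : 0 ≤ τ) (hh : 0 ≤ h)
    {U V : ℝ → Matrix n n ℂ}
    (hU : ∀ t ∈ Icc 0 τ, HasDerivWithinAt U (A t * U t) (Icc 0 τ) t)
    (hV : ∀ t ∈ Icc τ (τ + h), HasDerivWithinAt V (A t * V t) (Icc τ (τ + h)) t)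
    (hUV : V τ = U τ) :
    ∀ t ∈ Icc 0 (τ + h), HasDerivWithinAt (fun s => if s ≤ τ then U s else V s)
      (A t * (if t ≤ τ then U t else V t)) (Icc 0 (τ + h)) t := by
  intro t ht
  set G : ℝ → Matrix n n ℂ := fun s => if s ≤ τ then U s else V s with hG
  have hGU : ∀ s ∈ Icc 0 τ, G s = U s := fun s hs => by simp [hG, hs.2]
  have hGV : ∀ s ∈ Icc τ (τ + h), G s = V s := fun s hs => by
    by_cases hs' : s ≤ τ
    · have : s = τ := le_antisymm hs' hs.1
      simp [hG, this, hUV]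
    · simp [hG, hs']
  rcases lt_trichotomy t τ with hlt | rfl | hgt
  · -- interior of the left piece
    have h1 : HasDerivWithinAt G (A t * U t) (Icc 0 τ) t :=
      (hU t ⟨ht.1, hlt.le⟩).congr hGU (hGU t ⟨ht.1, hlt.le⟩)
    rw [if_pos hlt.le]
    refine (hasDerivWithinAt_congr_set ?_).mp h1
    -- `Icc 0 τ` and `Icc 0 (τ + h)` agree near `t < τ`
    filter_upwards [Iio_mem_nhds hlt] with s hs
    simp only [mem_Iio] at hs
    simp only [eq_iff_iff]
    constructor
    · rintro ⟨h0, _⟩; exact ⟨h0, by linarith⟩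
    · rintro ⟨h0, _⟩; exact ⟨h0, hs.le⟩
  · -- the junction `t = τ`
    rw [if_pos le_rfl]
    have h1 : HasDerivWithinAt G (A t * U t) (Icc 0 t) t :=
      (hU t ⟨ht.1, le_rfl⟩).congr hGU (hGU t ⟨ht.1, le_rfl⟩)
    have h2 : HasDerivWithinAt G (A t * U t) (Icc t (t + h)) t := by
      have := (hV t ⟨le_rfl, by linarith⟩).congr hGV (hGV t ⟨le_rfl, by linarith⟩)
      rwa [hUV] at this
    have h3 := h1.union h2
    rwa [Icc_union_Icc_eq_Icc ht.1 (by linarith)] at h3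
  · -- interior of the right piece
    have h1 : HasDerivWithinAt G (A t * V t) (Icc τ (τ + h)) t :=
      (hV t ⟨hgt.le, ht.2⟩).congr hGV (hGV t ⟨hgt.le, ht.2⟩)
    rw [if_neg (not_le.mpr hgt)]
    refine (hasDerivWithinAt_congr_set ?_).mp h1
    filter_upwards [Ioi_mem_nhds hgt] with s hs
    simp only [mem_Ioi] at hs
    simp only [eq_iff_iff]
    constructor
    · rintro ⟨_, h2⟩; exact ⟨by linarith, h2⟩
    · rintro ⟨_, h2⟩; exact ⟨hs.le, h2⟩

/-- **Global solutions of a linear matrix ODE, by steps.** For a continuous, bounded coefficient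
`A` and the step `h = 1/(2M+1)`: for every `k ≥ 1` there is `U` with `U 0 = 1` solving
`U' = A(s) U` on `[0, k h]`. [folklore] -/
theorem exists_linearODE_steps {A : ℝ → Matrix n n ℂ} (hA : Continuous A) {M : ℝ} (hM0 : 0 ≤ M)
    (hM : ∀ s, ‖A s‖ ≤ M) (k : ℕ) :
    ∃ U : ℝ → Matrix n n ℂ, U 0 = 1 ∧
      ∀ t ∈ Icc 0 ((k + 1 : ℕ) * (1 / (2 * M + 1))),
        HasDerivWithinAt U (A t * U t) (Icc 0 ((k + 1 : ℕ) * (1 / (2 * M + 1)))) t := by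
  set h : ℝ := 1 / (2 * M + 1) with hh
  have hpos : 0 < 2 * M + 1 := by linarith
  have hh0 : 0 ≤ h := by rw [hh]; positivity
  have hh1 : h * (2 * M + 1) ≤ 1 := by rw [hh, div_mul_cancel₀ _ hpos.ne']
  induction k with
  | zero =>
    obtain ⟨V, hV0, hV⟩ := exists_linearODE_step hA hM0 hM 0 h hh0 hh1 1
    refine ⟨V, hV0, ?_⟩
    simpa using hV
  | succ k ih =>
    obtain ⟨U, hU0, hU⟩ := ih
    set τ : ℝ := ((k + 1 : ℕ) : ℝ) * h with hτ
    have hτ0 : 0 ≤ τ := by rw [hτ]; positivity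
    obtain ⟨V, hV0, hV⟩ := exists_linearODE_step hA hM0 hM τ h hh0 hh1 (U τ)
    refine ⟨fun s => if s ≤ τ then U s else V s, by simp [hτ0, hU0], ?_⟩
    have hnext : ((k + 1 + 1 : ℕ) : ℝ) * h = τ + h := by rw [hτ]; push_cast; ring
    rw [hnext]
    exact glue_linearODE hτ0 hh0 hU hV hV0

/-- **Global solutions of a linear matrix ODE.** For a continuous coefficient `A : ℝ → Matrix`
bounded by `M` and every `T` there is `U` with `U 0 = 1` and `U' = A(s) U(s)` on `[0, T]`
(derivatives within the interval). [folklore] -/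
theorem exists_linearODE_solution {A : ℝ → Matrix n n ℂ} (hA : Continuous A) {M : ℝ}
    (hM : ∀ s, ‖A s‖ ≤ M) (T : ℝ) :
    ∃ U : ℝ → Matrix n n ℂ, U 0 = 1 ∧
      ∀ t ∈ Icc 0 T, HasDerivWithinAt U (A t * U t) (Icc 0 T) t := by
  have hM0 : 0 ≤ M := (norm_nonneg _).trans (hM 0)
  -- number of steps
  obtain ⟨k, hk⟩ := exists_nat_ge (T * (2 * M + 1))
  obtain ⟨U, hU0, hU⟩ := exists_linearODE_steps hA hM0 hM k
  have hpos : 0 < 2 * M + 1 := by linarith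
  have hTle : T ≤ ((k + 1 : ℕ) : ℝ) * (1 / (2 * M + 1)) := by
    rw [mul_one_div, le_div_iff₀ hpos]
    push_cast
    nlinarith
  refine ⟨U, hU0, fun t ht => ?_⟩
  exact (hU t ⟨ht.1, ht.2.trans hTle⟩).mono (Icc_subset_Icc le_rfl hTle)

/-! ### The unitary flow generated by a Hermitian family and its intertwining property -/

/-- Conjugate transposition as a continuous `ℝ`-linear map (for differentiating `s ↦ U(s)ᴴ`).
[folklore] -/
theorem hasDerivWithinAt_conjTranspose {U : ℝ → Matrix n n ℂ} {U' : Matrix n n ℂ} {S : Set ℝ}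
    {s : ℝ} (h : HasDerivWithinAt U U' S s) :
    HasDerivWithinAt (fun u => (U u)ᴴ) U'ᴴ S s := by
  let L : Matrix n n ℂ →ₗ[ℝ] Matrix n n ℂ :=
    { toFun := fun M => Mᴴ
      map_add' := fun M N => Matrix.conjTranspose_add M N
      map_smul' := fun c M => by
        ext i j
        simp [Matrix.conjTranspose_apply, Matrix.smul_apply] }
  have hL := (LinearMap.toContinuousLinearMap L).hasFDerivAt (x := U s)
  exact hL.comp_hasDerivWithinAt s h

omit [Fintype n] [DecidableEq n] in
/-- `(i D)ᴴ = −(i D)` for Hermitian `D`. [folklore] -/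
theorem conjTranspose_I_smul_of_isHermitian {D : Matrix n n ℂ} (hD : D.IsHermitian) :
    ((Complex.I : ℂ) • D)ᴴ = -((Complex.I : ℂ) • D) := by
  rw [Matrix.conjTranspose_smul, hD.eq, Complex.star_def, Complex.conj_I, neg_smul]

/-- **The unitary flow of a continuous bounded Hermitian generator, and its intertwining
property.** Let `D : ℝ → Matrix` be continuous, bounded and pointwise Hermitian, and let
`P : ℝ → Matrix` satisfy Hastings' equation `P' = i[D(s), P(s)]` on `[0, T]` (derivatives
within the interval). Then the solution of `U' = i D(s) U`, `U(0) = 1` exists on `[0, T]`, is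
unitary, and intertwines: `U(s)ᴴ P(s) U(s) = P(0)`, i.e. `P(s) = U(s) P(0) U(s)ᴴ`.
Michalakis–Zwolak, arXiv:1109.1588 §5.2 ("`∂_s U_Y(s) = i D_Y(s) U_Y(s)`, `U_Y(0) = 𝟙`", "the
unitary `U(s)` satisfies `U(s) P₀ U†(s) = P₀(s)`"), after Bachmann–Michalakis–Nachtergaele–Sims
(2011), eq. (4.42)–(4.46) and Proposition 2.4. [folklore] -/
theorem exists_unitary_flow {D P : ℝ → Matrix n n ℂ} (hDc : Continuous D) {M : ℝ}
    (hDM : ∀ s, ‖D s‖ ≤ M) (hDh : ∀ s, (D s).IsHermitian) (T : ℝ)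
    (hP : ∀ s ∈ Icc 0 T, HasDerivWithinAt P
      ((Complex.I : ℂ) • (D s * P s - P s * D s)) (Icc 0 T) s) :
    ∃ U : ℝ → Matrix n n ℂ, U 0 = 1 ∧
      (∀ s ∈ Icc 0 T, HasDerivWithinAt U (((Complex.I : ℂ) • D s) * U s) (Icc 0 T) s) ∧
      (∀ s ∈ Icc 0 T, (U s)ᴴ * U s = 1) ∧ (∀ s ∈ Icc 0 T, U s * (U s)ᴴ = 1) ∧
      (∀ s ∈ Icc 0 T, (U s)ᴴ * P s * U s = P 0) := by
  set A : ℝ → Matrix n n ℂ := fun s => (Complex.I : ℂ) • D s with hA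
  have hAc : Continuous A := by
    rw [hA]
    exact hDc.const_smul (Complex.I : ℂ)
  have hAM : ∀ s, ‖A s‖ ≤ M := fun s => by
    rw [hA]
    simp only [norm_smul, Complex.norm_I, one_mul]
    exact hDM s
  obtain ⟨U, hU0, hU⟩ := exists_linearODE_solution hAc hAM T
  have hAct : ∀ s, (A s)ᴴ = -A s := fun s => conjTranspose_I_smul_of_isHermitian (hDh s)
  -- within `Ici s` versions of the derivatives (for the constancy lemma)
  have hnhds : ∀ s ∈ Ico 0 T, Icc 0 T ∈ 𝓝[Ici s] s := fun s hs =>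
    mem_of_superset (Icc_mem_nhdsGE hs.2) (Icc_subset_Icc hs.1 le_rfl)
  -- (U1) unitarity: `Q = Uᴴ U` has zero derivative
  have hQd : ∀ s ∈ Icc 0 T, HasDerivWithinAt (fun u => (U u)ᴴ * U u) 0 (Icc 0 T) s := by
    intro s hs
    have h1 := (hasDerivWithinAt_conjTranspose (hU s hs)).mul (hU s hs)
    refine h1.congr_deriv ?_
    rw [Matrix.conjTranspose_mul, hAct s]
    noncomm_ring
  have hQc : ContinuousOn (fun u => (U u)ᴴ * U u) (Icc 0 T) := fun s hs =>
    (hQd s hs).continuousWithinAt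
  have hQ : ∀ s ∈ Icc 0 T, (U s)ᴴ * U s = 1 := by
    intro s hs
    have h := constant_of_has_deriv_right_zero hQc
      (fun x hx => (hQd x ⟨hx.1, hx.2.le⟩).mono_of_mem_nhdsWithin (hnhds x hx)) s hs
    rw [h, hU0, Matrix.conjTranspose_one, Matrix.mul_one]
  have hQ' : ∀ s ∈ Icc 0 T, U s * (U s)ᴴ = 1 := fun s hs =>
    mul_eq_one_comm.mp (hQ s hs)
  -- (U2) intertwining: `R = Uᴴ P U` has zero derivative
  have hRd : ∀ s ∈ Icc 0 T, HasDerivWithinAt (fun u => (U u)ᴴ * P u * U u) 0 (Icc 0 T) s := by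
    intro s hs
    have hAP : (Complex.I : ℂ) • (D s * P s - P s * D s) = A s * P s - P s * A s := by
      rw [hA]
      simp only [Matrix.smul_mul, Matrix.mul_smul, smul_sub]
    have hPs : HasDerivWithinAt P (A s * P s - P s * A s) (Icc 0 T) s :=
      hAP ▸ hP s hs
    have h1 := ((hasDerivWithinAt_conjTranspose (hU s hs)).mul hPs).mul (hU s hs)
    refine h1.congr_deriv ?_
    simp only [Pi.mul_apply, Matrix.conjTranspose_mul, hAct s]
    noncomm_ring
  have hRc : ContinuousOn (fun u => (U u)ᴴ * P u * U u) (Icc 0 T) := fun s hs =>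
    (hRd s hs).continuousWithinAt
  have hR : ∀ s ∈ Icc 0 T, (U s)ᴴ * P s * U s = P 0 := by
    intro s hs
    have h := constant_of_has_deriv_right_zero hRc
      (fun x hx => (hRd x ⟨hx.1, hx.2.le⟩).mono_of_mem_nhdsWithin (hnhds x hx)) s hs
    rw [h, hU0, Matrix.conjTranspose_one, Matrix.one_mul, Matrix.mul_one]
  exact ⟨U, hU0, hU, hQ, hQ', hR⟩

end Literature.MathematicalPhysics.QuantumLattice
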